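import Summits.Parity.GeneralizedHardyLittlewood.Theorems.LeeYangFibresCellParityLawDefs
import Summits.Parity.GeneralizedHardyLittlewood.Theorems.LeeYangFibresCellParityLawSieveDefs
import Summits.Parity.GeneralizedHardyLittlewood.Theorems.LeeYangFibresCellParityLawSingularRatio
import Literature.NumberTheory.Sieve.SieveFunctions
import Literature.NumberTheory.Sieve.SieveFramework
import Literature.NumberTheory.Sieve.RosserSieveTheoremOneHalfLt
import Literature.NumberTheory.Sieve.SieveFunctionsBridge
import Literature.NumberTheory.Sieve.LinearSieveConstant
import Literature.NumberTheory.Sieve.LinearFormsRoughTupleBound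
import Literature.NumberTheory.Sieve.LinearEquationsInPrimesSubsystems
import Literature.NumberTheory.Sieve.RoughOmegaCellsLocalAPPrep
import HarnessLib

/-!
# Route `LeeYangFibres`, crux `CellParityLaw` (stmt-Parity-14109), line `section-annihilator`:
# the registered stub `stub_prLawTwoTopCell` — the top cell at `u = 2`

We prove `PrLawTwoTopCell` (vocabulary `LeeYangFibresCellParityLawSieveDefs`): granted the bookkeeping
of the section sequences (`SectionSeqFacts`), the uniform dimension `Ω(1, L')` of the section densities
(`SectionDimension`), the crude Mertens-side bound (`SectionMertens`), the preparations (`PrLawTwoPrep`)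
and the atom (`SectionLevelAt t`), the TOP CELL of a coordinate section at roughness `u = 2` — lattice
points `n ∈ [-N, N] ∩ K` with `ψ_i(n) = p₁ p₂`, `N^{1/2} < p₁ ≤ p₂`, the other forms frozen in their rough
`Ω`-cells — is `≤ N / (log^{t+1} N (log log N)^B)` for `N ≥ N₀(t, L, B)` in the non-degenerate case.

Proof (assembly only). With `x = 2LN ≥ ψ_i` on the box and `M = ⌈√x⌉`, the top cell is at most
`∑_{N^{1/2} < p ≤ M} S(b_p, z)`, `z = N^{1/8}`, `b_p(q) = b(pq)` (`SectionSeqFacts` (d)). Iwaniec's linear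
sieve (`Iwaniec1980_thm1_upper_of_half_lt`, `κ = 1`, uniform over `Ω(1, L')`; `y = N^{1/4}`, `s = 2`,
`F(2) = e^γ`) gives `S(b_p, z) ≤ g(p) F V(z) (e^γ + |C_I|) + ∑_{d < y, d ∣ P(z)} |R_d|`, where `R_d` IS
the atom's discrepancy at the modulus `pd` (`d` coprime to `p > N^{1/2} ≥ z`; `SectionSeqFacts` (b)).
Summing over `p`: `∑_p g(p) ≤ (log(√(2L) + 2) + |L'|)/log N^{1/2}` is read off `Ω(1, L')` through
`g ≤ log (1 - g)⁻¹`; `V(N^{1/8}) ≤ 8 C log log N / log N` (`SectionMertens`, crude clause);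
`F ≤ C (log log N)^t N / log^t N` (`PrLawTwoPrep` (c), `uniformRoughTupleBound`); the remainders re-index
injectively through `(p, d) ↦ pd ≤ N^{7/8} ≤ N^{1 - 1/log log N}` into the atom's squarefree moduli
(`PrLawTwoPrep` (e)), where the atom saves `log^{-(t+3)} N`. Total
`≪ (log log N)^{t+1} N / log^{t+2} N + N / log^{t+3} N`, within the budget as `(log log N)^n = o(log N)`.
References: H. Iwaniec, Acta Arith. 36 (1980) 171–202, Thm 1 [IwaniecActaArith1980]; E. Bombieri, RIMS
Kôkyûroku 294 (1977) p. 5 [BombieriRIMS1977].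
-/

noncomputable section

open scoped BigOperators Topology Classical
open Finset Filter Literature.NumberTheory.Sieve

namespace Summit.Parity.GeneralizedHardyLittlewood.Cruxes.CellParityLaw.SectionAnnihilator

namespace TopCellAux

/-- `V(z)` of a divisor sequence of the section sequence is the Mertens-type product of the section
density over the primes `< z`. -/
theorem densityProduct_sectionSeq {t : ℕ} (Ψ : Fin (t + 1) → AffLinForm 1) (K : Set (Fin 1 → ℝ))
    (N u : ℕ) (i : Fin (t + 1)) (j' : Fin t → ℕ) (e : ℕ) (z : ℝ) :
    (sectionSeq Ψ K N u i j' e).densityProduct (primesProdBelow z) =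
      ∏ q ∈ Nat.primesBelow ⌈z⌉₊, (1 - sectionDensity Ψ i q) := by
  unfold SieveSequence.densityProduct
  rw [primeFactors_primesProdBelow]
  refine Finset.prod_congr rfl fun q hq => ?_
  show 1 - sectionDensityFn Ψ i q = _
  rw [sectionDensityFn_apply Ψ i (Nat.prime_of_mem_primesBelow hq).ne_zero]

/-- **The window bound** read off `Ω(1, L')`: for primes `p` with `w ≤ p < z ≤ c w` (`w ≥ 2`, `c ≥ 1`),
`∑_p g(p) ≤ ∑_p log (1 - g(p))⁻¹ ≤ log ((log z / log w)(1 + L'/log w)) ≤ (log c + |L'|)/log w`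
(`g ≤ log (1 - g)⁻¹` from `1 - g ≤ e^{-g}`; `log (ab) ≤ (a - 1) + (b - 1)`). -/
theorem window_sum_le {t : ℕ} {Ψ : Fin (t + 1) → AffLinForm 1} {i : Fin (t + 1)} {L' : ℝ}
    (hdim : HasIwaniecDimension (sectionDensityFn Ψ i) 1 L') {w z c : ℝ} (hw : 2 ≤ w) (hc : 1 ≤ c)
    (hz : z ≤ c * w) (W : Finset ℕ) (hW : ∀ p ∈ W, p.Prime ∧ w ≤ (p : ℝ) ∧ (p : ℝ) < z) :
    ∑ p ∈ W, sectionDensity Ψ i p ≤ (Real.log c + |L'|) / Real.log w := by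
  have hw0 : 0 < w := by linarith
  have hlogw : 0 < Real.log w := Real.log_pos (by linarith)
  rcases W.eq_empty_or_nonempty with rfl | ⟨p₀, hp₀⟩
  · rw [Finset.sum_empty]
    exact div_nonneg (add_nonneg (Real.log_nonneg hc) (abs_nonneg _)) hlogw.le
  have hwz : w ≤ z := by have h := hW p₀ hp₀; linarith [h.2.1, h.2.2]
  have ha : 0 < Real.log z / Real.log w := div_pos (by linarith [Real.log_le_log hw0 hwz]) hlogw
  have hb : 0 < 1 + L' / Real.log w := by have := hdim.nonneg; positivity
  have hlogzc : Real.log z ≤ Real.log c + Real.log w := by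
    rw [← Real.log_mul (by linarith) hw0.ne']
    exact Real.log_le_log (by linarith) hz
  set g := sectionDensityFn Ψ i with hg
  set S := (Nat.primesBelow ⌈z⌉₊).filter (fun p : ℕ => w ≤ (p : ℝ)) with hS
  have hlt : ∀ p ∈ S, 0 ≤ g p ∧ g p < 1 := fun p hp =>
    hdim.1 p (Nat.prime_of_mem_primesBelow (Finset.mem_filter.mp hp).1)
  have hfac : ∀ p ∈ S, 0 < (1 - g p)⁻¹ := fun p hp => inv_pos.mpr (sub_pos.mpr (hlt p hp).2)
  calc ∑ p ∈ W, sectionDensity Ψ i p = ∑ p ∈ W, g p :=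
        Finset.sum_congr rfl fun p hp => (sectionDensityFn_apply Ψ i (hW p hp).1.ne_zero).symm
    _ ≤ ∑ p ∈ S, g p :=
        Finset.sum_le_sum_of_subset_of_nonneg (fun p hp => Finset.mem_filter.mpr
          ⟨Nat.mem_primesBelow.mpr ⟨Nat.lt_ceil.mpr (hW p hp).2.2, (hW p hp).1⟩, (hW p hp).2.1⟩)
          fun p hp _ => (hlt p hp).1
    _ ≤ ∑ p ∈ S, Real.log (1 - g p)⁻¹ := by
        refine Finset.sum_le_sum fun p hp => ?_
        have h2 : Real.log (1 - g p) ≤ -g p := by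
          rw [Real.log_le_iff_le_exp (sub_pos.mpr (hlt p hp).2)]
          linarith [Real.add_one_le_exp (-g p)]
        rw [Real.log_inv]
        linarith
    _ = Real.log (∏ p ∈ S, (1 - g p)⁻¹) := (Real.log_prod fun p hp => (hfac p hp).ne').symm
    _ ≤ Real.log (Real.log z / Real.log w * (1 + L' / Real.log w)) := by
        refine Real.log_le_log (Finset.prod_pos hfac) ?_
        have := hdim.2 w z hw hwz
        rwa [Real.rpow_one] at this
    _ = Real.log (Real.log z / Real.log w) + Real.log (1 + L' / Real.log w) :=
        Real.log_mul ha.ne' hb.ne'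
    _ ≤ (Real.log z / Real.log w - 1) + (1 + L' / Real.log w - 1) :=
        add_le_add (Real.log_le_sub_one_of_pos ha) (Real.log_le_sub_one_of_pos hb)
    _ = (Real.log z - Real.log w + L') / Real.log w := by
        field_simp
        ring
    _ ≤ (Real.log c + |L'|) / Real.log w := by
        apply div_le_div_of_nonneg_right _ hlogw.le
        linarith [le_abs_self L']

/-- Budget, main part: `K m^{t+1} N / ℓ^{t+2} ≤ N / (2 ℓ^{t+1} m^B)` once `2 K m^{t+1+B} ≤ ℓ`. -/
theorem main_le_half {K ℓ m Nr : ℝ} {t B : ℕ} (hℓ : 0 < ℓ) (hm : 0 < m) (hN : 0 ≤ Nr)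
    (h : 2 * K * m ^ (t + 1 + B) ≤ ℓ) :
    K * m ^ (t + 1) * Nr / ℓ ^ (t + 2) ≤ Nr / (ℓ ^ (t + 1) * m ^ B) / 2 := by
  rw [div_div, div_le_div_iff₀ (by positivity) (by positivity)]
  calc K * m ^ (t + 1) * Nr * (ℓ ^ (t + 1) * m ^ B * 2)
      = Nr * ℓ ^ (t + 1) * (2 * K * m ^ (t + 1 + B)) := by ring
    _ ≤ Nr * ℓ ^ (t + 1) * ℓ := mul_le_mul_of_nonneg_left h (by positivity)
    _ = Nr * ℓ ^ (t + 2) := by ring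

/-- Budget, remainder part: `N / ℓ^{t+3} ≤ N / (2 ℓ^{t+1} m^B)` once `2 m^B ≤ ℓ`, `ℓ ≥ 1`. -/
theorem rem_le_half {ℓ m Nr : ℝ} {t B : ℕ} (hℓ : 1 ≤ ℓ) (hm : 0 < m) (hN : 0 ≤ Nr)
    (h : 2 * m ^ B ≤ ℓ) : Nr / ℓ ^ (t + 3) ≤ Nr / (ℓ ^ (t + 1) * m ^ B) / 2 := by
  have hℓ0 : 0 < ℓ := by linarith
  rw [div_div, div_le_div_iff₀ (by positivity) (by positivity)]
  calc Nr * (ℓ ^ (t + 1) * m ^ B * 2) = Nr * ℓ ^ (t + 1) * (2 * m ^ B) := by ring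
    _ ≤ Nr * ℓ ^ (t + 1) * ℓ := mul_le_mul_of_nonneg_left h (by positivity)
    _ ≤ Nr * ℓ ^ (t + 1) * ℓ ^ 2 := mul_le_mul_of_nonneg_left (by nlinarith) (by positivity)
    _ = Nr * ℓ ^ (t + 3) := by ring

/-- The re-indexed moduli fit under the atom's level: `p d ≤ N^{7/8} ≤ N^{1 - 1/log log N}` for
`p ≤ M`, `M + 1 ≤ c N^{1/2}`, `c ≤ N^{1/8}`, `d < N^{1/4}` and `log log N ≥ 8`. -/
theorem mul_le_level {N M p d : ℕ} {c : ℝ} (hN1 : (1 : ℝ) ≤ N) (hc : c ≤ (N : ℝ) ^ ((1 : ℝ) / 8))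
    (hM : (M : ℝ) + 1 ≤ c * (N : ℝ) ^ ((1 : ℝ) / 2)) (hm : 8 ≤ Real.log (Real.log N))
    (hp : p ≤ M) (hd : d < ⌈(N : ℝ) ^ ((1 : ℝ) / 4)⌉₊) :
    p * d ≤ ⌊(N : ℝ) ^ (1 - 1 / Real.log (Real.log N) ^ 1)⌋₊ := by
  have hN0 : (0 : ℝ) < N := by linarith
  rw [Nat.le_floor_iff (Real.rpow_nonneg hN0.le _), Nat.cast_mul]
  have hp' : (p : ℝ) ≤ c * (N : ℝ) ^ ((1 : ℝ) / 2) := by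
    have : (p : ℝ) ≤ M := by exact_mod_cast hp
    linarith
  have hd' : (d : ℝ) < (N : ℝ) ^ ((1 : ℝ) / 4) := Nat.lt_ceil.mp hd
  have hexp : (7 : ℝ) / 8 ≤ 1 - 1 / Real.log (Real.log N) ^ 1 := by
    rw [pow_one]
    have : 1 / Real.log (Real.log N) ≤ 1 / 8 := by
      rw [div_le_div_iff₀ (by linarith) (by norm_num)]
      linarith
    linarith
  calc (p : ℝ) * d ≤ (c * (N : ℝ) ^ ((1 : ℝ) / 2)) * (N : ℝ) ^ ((1 : ℝ) / 4) :=
        mul_le_mul hp' hd'.le (Nat.cast_nonneg d) ((Nat.cast_nonneg p).trans hp')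
    _ ≤ ((N : ℝ) ^ ((1 : ℝ) / 8) * (N : ℝ) ^ ((1 : ℝ) / 2)) * (N : ℝ) ^ ((1 : ℝ) / 4) := by
        gcongr
    _ = (N : ℝ) ^ ((7 : ℝ) / 8) := by
        rw [← Real.rpow_add hN0, ← Real.rpow_add hN0]
        norm_num
    _ ≤ (N : ℝ) ^ (1 - 1 / Real.log (Real.log N) ^ 1) := Real.rpow_le_rpow_of_exponent_le hN1 hexp

/-! ## The linear sieve on the divisor sequences, summed over the window -/

/-- **The top cell at `u = 2` against four numerical bounds.** By `SectionSeqFacts` (d) the top cell is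
at most `∑_{N^{1/2} < p ≤ M} S(b_p, z)`; Iwaniec's linear sieve on the divisor sequence `b_p` at `s = 2`
gives the main term `g(p) F V(z) (F(2) + |C_I|)` (using `log^{-1/3} y ≤ 1`) and remainders `R_d`, `d < y`,
`d ∣ P(z)` (so `d` is coprime to `p ≥ z`), which ARE the atom's discrepancies at the moduli `pd`
(`SectionSeqFacts` (b)); then ANY bounds `a` for the window sum `∑_p g(p)`, `b` for the fibre mass `F`,
`v` for `V(z)` and `r` for the re-indexed remainders give `C_{(2,j')} ≤ a b v (F(2) + |C_I|) + r`. -/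
theorem cell_two_le (hSF : SectionSeqFacts) {t : ℕ} (Ψ : Fin (t + 1) → AffLinForm 1)
    (K : Set (Fin 1 → ℝ)) (N : ℕ) (i : Fin (t + 1)) (j' : Fin t → ℕ) {L' CI G : ℝ} {Fup : ℝ → ℝ}
    (hI : ∀ A : SieveSequence, HasIwaniecDimension A.density 1 L' → ∀ x y z : ℝ, 2 ≤ z → z ≤ y →
      0 ≤ A.size x → A.sifted x (primesProdBelow z) ≤
        A.size x * A.densityProduct (primesProdBelow z) *
            (Fup (Real.log y / Real.log z) + CI * Real.log y ^ (-(1 / 3 : ℝ))) +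
          ∑ d ∈ (Finset.range ⌈y⌉₊).filter (· ∣ primesProdBelow z), |A.remainder d x|)
    (hF2 : Fup 2 = G) (hG : 0 ≤ G) (hdim : HasIwaniecDimension (sectionDensityFn Ψ i) 1 L')
    {x y z : ℝ} {M : ℕ} (hx : 0 ≤ x) (hvals : ∀ n ∈ latticeBox 1 N, (((Ψ i).eval n : ℤ) : ℝ) ≤ x)
    (hvalsM : ∀ n ∈ latticeBox 1 N, (Ψ i).eval n ≤ (M : ℤ) ^ 2)
    (hz2 : 2 ≤ z) (hzy : z ≤ y) (hs : Real.log y / Real.log z = 2) (hy1 : 1 ≤ Real.log y)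
    (hzN : z ≤ (N : ℝ) ^ ((1 : ℝ) / 2)) {a b v r : ℝ}
    (ha : ∑ p ∈ (Finset.Icc 1 M).filter (fun p : ℕ => p.Prime ∧ (N : ℝ) ^ ((1 : ℝ) / 2) < (p : ℝ)),
      sectionDensity Ψ i p ≤ a)
    (hb : (sectionMass Ψ K N 2 i j' 1 : ℝ) ≤ b)
    (hv : ∏ q ∈ Nat.primesBelow ⌈z⌉₊, (1 - sectionDensity Ψ i q) ≤ v)
    (hr : ∑ p ∈ (Finset.Icc 1 M).filter (fun p : ℕ => p.Prime ∧ (N : ℝ) ^ ((1 : ℝ) / 2) < (p : ℝ)),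
      ∑ d ∈ (Finset.range ⌈y⌉₊).filter (· ∣ primesProdBelow z),
        |(sectionMass Ψ K N 2 i j' (p * d) : ℝ) -
            sectionDensity Ψ i (p * d) * (sectionMass Ψ K N 2 i j' 1 : ℝ)| ≤ r) :
    (cell Ψ K N 2 (i.insertNth 2 j') : ℝ) ≤ a * (b * (v * (G + |CI|))) + r := by
  have hg0 : ∀ p : ℕ, p.Prime → 0 ≤ sectionDensity Ψ i p := fun p hp => by
    have h := (hdim.1 p hp).1
    rwa [sectionDensityFn_apply Ψ i hp.ne_zero] at h
  have hV0 : 0 ≤ ∏ q ∈ Nat.primesBelow ⌈z⌉₊, (1 - sectionDensity Ψ i q) := by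
    refine Finset.prod_nonneg fun q hq => ?_
    have hq := Nat.prime_of_mem_primesBelow hq
    have h := (hdim.1 q hq).2
    rw [sectionDensityFn_apply Ψ i hq.ne_zero] at h
    linarith
  have hB0 : 0 ≤ (sectionMass Ψ K N 2 i j' 1 : ℝ) := Nat.cast_nonneg _
  have hGC : 0 ≤ G + |CI| := by positivity
  have ha0 : 0 ≤ ∑ p ∈ (Finset.Icc 1 M).filter
      (fun p : ℕ => p.Prime ∧ (N : ℝ) ^ ((1 : ℝ) / 2) < (p : ℝ)), sectionDensity Ψ i p :=
    Finset.sum_nonneg fun p hp => hg0 p (Finset.mem_filter.mp hp).2.1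
  -- the error factor `C_I log^{-1/3} y ≤ |C_I|`
  have hE : CI * Real.log y ^ (-(1 / 3 : ℝ)) ≤ |CI| := by
    have h0 : 0 ≤ Real.log y ^ (-(1 / 3 : ℝ)) := Real.rpow_nonneg (by linarith) _
    have h1 : Real.log y ^ (-(1 / 3 : ℝ)) ≤ 1 := Real.rpow_le_one_of_one_le_of_nonpos hy1 (by norm_num)
    nlinarith [le_abs_self CI, abs_nonneg CI, mul_le_mul_of_nonneg_right (le_abs_self CI) h0]
  refine ((hSF t Ψ K N 2 i j').2.2.2 x z M rfl hvals hvalsM hz2 hzN).trans ?_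
  refine le_trans ?_ (add_le_add (mul_le_mul ha (mul_le_mul hb (mul_le_mul_of_nonneg_right hv hGC)
    (mul_nonneg hV0 hGC) (hB0.trans hb)) (mul_nonneg hB0 (mul_nonneg hV0 hGC)) (ha0.trans ha)) hr)
  rw [Finset.sum_mul, ← Finset.sum_add_distrib]
  refine Finset.sum_le_sum fun p hp => ?_
  -- the linear sieve on the divisor sequence `b_p`, `p` prime, `p > N^{1/2} ≥ z`
  obtain ⟨hp, hpN⟩ := (Finset.mem_filter.mp hp).2
  have hzp : z ≤ p := hzN.trans hpN.le
  have hsize : (sectionSeq Ψ K N 2 i j' p).size x =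
      sectionDensity Ψ i p * (sectionMass Ψ K N 2 i j' 1 : ℝ) := rfl
  have hmain := hI (sectionSeq Ψ K N 2 i j' p) hdim x y z hz2 hzy
    (by rw [hsize]; exact mul_nonneg (hg0 p hp) hB0)
  rw [hs, hF2, hsize, densityProduct_sectionSeq] at hmain
  -- its remainders are the atom's discrepancies at the moduli `p d`
  have hrem : ∀ d ∈ (Finset.range ⌈y⌉₊).filter (· ∣ primesProdBelow z),
      |(sectionSeq Ψ K N 2 i j' p).remainder d x| =
        |(sectionMass Ψ K N 2 i j' (p * d) : ℝ) -
            sectionDensity Ψ i (p * d) * (sectionMass Ψ K N 2 i j' 1 : ℝ)| := by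
    intro d hd
    have hdP : d ∣ primesProdBelow z := (Finset.mem_filter.mp hd).2
    have hcop : Nat.Coprime p d := by
      rw [Nat.Prime.coprime_iff_not_dvd hp]
      intro hpd
      have hlt := (dvd_primesProdBelow_iff hp z).mp (hpd.trans hdP)
      linarith
    have hp1' : (1 : ℝ) ≤ p := by exact_mod_cast hp.one_lt.le
    rw [(hSF t Ψ K N 2 i j').2.1 p x hp.one_lt.le
      (fun n hn => (hvals n hn).trans (le_mul_of_one_le_left hx hp1')) d
      (ne_zero_of_dvd_ne_zero (primesProdBelow_ne_zero z) hdP) hcop]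
  rw [Finset.sum_congr rfl hrem] at hmain
  refine hmain.trans (add_le_add ?_ le_rfl)
  have hgBV := mul_nonneg (mul_nonneg (hg0 p hp) hB0) hV0
  have := mul_le_mul_of_nonneg_left (add_le_add (le_refl G) hE) hgBV
  linarith

end TopCellAux

open TopCellAux in
/-- **`stub_prLawTwoTopCell`** (registered stub of skeleton v9): the top cell at `u = 2` is within the
budget `N/(log^{t+1} N (log log N)^B)` in the non-degenerate case — Iwaniec's linear sieve at `s = 2`
(`z = N^{1/8}`, `y = N^{1/4}`) on each divisor sequence `b_p`, `N^{1/2} < p ≤ ⌈√(2LN)⌉`, the window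
bound `∑_p g(p) ≪ 1/log N` read off `Ω(1, L')`, the crude Mertens bound for `V(N^{1/8})`, the rough-tuple
bound for the fibre mass, and the atom's remainders re-indexed through `(p, d) ↦ pd`. -/
theorem stub_prLawTwoTopCell : PrLawTwoTopCell := by
  intro hSF hDim hMer hPrep t _ht hA L B
  -- constants: `L'`, Iwaniec's `F` and `C_I`, Mertens' `C3`, rough tuples' `CR`, the atom's threshold
  obtain ⟨L', hL'⟩ := hDim t
  obtain ⟨Bd, hBd, hBC⟩ := Iwaniec1980_thm1_upper_of_half_lt (κ := 1) (by norm_num)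
  obtain ⟨CI, hCI⟩ := hBC L'
  set G := Real.exp Real.eulerMascheroniConstant with hG
  have hG0 : 0 < G := by rw [hG]; exact Real.exp_pos _
  have hF2 : Bd.1 2 = G := by
    have hFeq : Set.EqOn Bd.1 (iwaniecUpperSieveFun 1) (Set.Ioi 0) := hBd.eqOn_iwaniecSieveFun.1
    rw [hFeq (show (0 : ℝ) < 2 by norm_num), ← upperSieveFun_one,
      upperSieveFun_one_eq_holds ⟨by norm_num, by norm_num⟩, hG]
    ring
  obtain ⟨C3, N3, h3⟩ := hMer t L 1 le_rfl
  obtain ⟨CR, NR, hR⟩ := uniformRoughTupleBound t L 2 (by norm_num)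
  obtain ⟨NA, hAt⟩ := hA L 2 (t + 3) 1 le_rfl
  set c := Real.sqrt (2 * L) + 2 with hc
  have hc1 : 1 ≤ c := by have := Real.sqrt_nonneg (2 * (L : ℝ)); rw [hc]; linarith
  set KW := 2 * Real.log c + 2 * |L'| with hKW
  set KM := KW * |CR| * (8 * |C3|) * (G + |CI|) with hKM
  -- thresholds
  have hev : ∀ᶠ N : ℕ in atTop, (N3 ≤ N ∧ NR ≤ N ∧ NA ≤ N ∧ 256 ≤ N) ∧
      (4 ≤ Real.log N ∧ 8 ≤ Real.log (Real.log N) ∧ c ≤ (N : ℝ) ^ ((1 : ℝ) / 8)) ∧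
      (2 * KM * Real.log (Real.log N) ^ (t + 1 + B) ≤ Real.log N ∧
        2 * Real.log (Real.log N) ^ B ≤ Real.log N) := by
    have hlog : Tendsto (fun N : ℕ => Real.log (N : ℝ)) atTop atTop :=
      Real.tendsto_log_atTop.comp tendsto_natCast_atTop_atTop
    filter_upwards [eventually_ge_atTop N3, eventually_ge_atTop NR, eventually_ge_atTop NA,
      eventually_ge_atTop 256, hlog.eventually_ge_atTop 4,
      (Real.tendsto_log_atTop.comp hlog).eventually_ge_atTop 8,
      ((tendsto_rpow_atTop (show (0 : ℝ) < 1 / 8 by norm_num)).comp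
        tendsto_natCast_atTop_atTop).eventually_ge_atTop c,
      Literature.NumberTheory.Sieve.RoughCellsLocal.eventually_mul_loglog_pow_le_log (2 * KM) (t + 1 + B),
      Literature.NumberTheory.Sieve.RoughCellsLocal.eventually_mul_loglog_pow_le_log 2 B]
      with N h1 h2 h3' h4 h5 h6 h7 h8 h9
    exact ⟨⟨h1, h2, h3', h4⟩, ⟨h5, h6, h7⟩, ⟨h8, h9⟩⟩
  obtain ⟨N₀, hN₀⟩ := Filter.eventually_atTop.1 hev
  refine ⟨N₀, fun N hN Ψ hΨ hΨL K hK hKN i j' hj' hlt1 hS => ?_⟩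
  obtain ⟨⟨hN3, hNR, hNA, h256⟩, ⟨hℓ4, hm8, hcN⟩, ⟨hKMℓ, h2ℓ⟩⟩ := hN₀ N hN
  -- basic quantities at the scale `N`
  have hNpos : 0 < N := by omega
  have hN0 : (0 : ℝ) < N := by exact_mod_cast hNpos
  have hN1 : (1 : ℝ) ≤ N := by exact_mod_cast hNpos
  have hℓ0 : 0 < Real.log N := by linarith
  have hm0 : 0 < Real.log (Real.log N) := by linarith
  have hdim := hL' Ψ i hlt1
  -- sieve parameters `z = N^{1/8}`, `y = N^{1/4}`; height `x = 2LN`; window end `M = ⌈√x⌉`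
  have hz2 : (2 : ℝ) ≤ (N : ℝ) ^ ((1 : ℝ) / 8) :=
    calc (2 : ℝ) = ((2 : ℝ) ^ (8 : ℕ)) ^ ((1 : ℝ) / 8) := by
          rw [← Real.rpow_natCast, ← Real.rpow_mul (by norm_num)]
          norm_num
      _ ≤ (N : ℝ) ^ ((1 : ℝ) / 8) :=
          Real.rpow_le_rpow (by norm_num) (by norm_num; exact_mod_cast h256) (by norm_num)
  have hzy : (N : ℝ) ^ ((1 : ℝ) / 8) ≤ (N : ℝ) ^ ((1 : ℝ) / 4) :=
    Real.rpow_le_rpow_of_exponent_le hN1 (by norm_num)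
  have hzhalf : (N : ℝ) ^ ((1 : ℝ) / 8) ≤ (N : ℝ) ^ ((1 : ℝ) / 2) :=
    Real.rpow_le_rpow_of_exponent_le hN1 (by norm_num)
  have hzN : (N : ℝ) ^ ((1 : ℝ) / 8) ≤ N := by
    simpa using Real.rpow_le_rpow_of_exponent_le hN1 (show (1 : ℝ) / 8 ≤ 1 by norm_num)
  have hlogz : Real.log ((N : ℝ) ^ ((1 : ℝ) / 8)) = 1 / 8 * Real.log N := Real.log_rpow hN0 _
  have hlogy : Real.log ((N : ℝ) ^ ((1 : ℝ) / 4)) = 1 / 4 * Real.log N := Real.log_rpow hN0 _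
  have hlogw : Real.log ((N : ℝ) ^ ((1 : ℝ) / 2)) = 1 / 2 * Real.log N := Real.log_rpow hN0 _
  have hs : Real.log ((N : ℝ) ^ ((1 : ℝ) / 4)) / Real.log ((N : ℝ) ^ ((1 : ℝ) / 8)) = 2 := by
    rw [hlogz, hlogy]; field_simp; norm_num
  have hy1 : 1 ≤ Real.log ((N : ℝ) ^ ((1 : ℝ) / 4)) := by rw [hlogy]; linarith
  have hw2 : (2 : ℝ) ≤ (N : ℝ) ^ ((1 : ℝ) / 2) := hz2.trans hzhalf
  have hx0 : (0 : ℝ) ≤ 2 * L * N := by positivity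
  have hvals : ∀ n ∈ latticeBox 1 N, (((Ψ i).eval n : ℤ) : ℝ) ≤ 2 * L * N :=
    hPrep.2.2.2.1 (t + 1) Ψ N L hNpos hΨL i
  have hsx : Real.sqrt (2 * L * N) = Real.sqrt (2 * L) * (N : ℝ) ^ ((1 : ℝ) / 2) := by
    rw [Real.sqrt_mul (by positivity) (N : ℝ), Real.sqrt_eq_rpow (N : ℝ)]
  have hvalsM : ∀ n ∈ latticeBox 1 N, (Ψ i).eval n ≤ (⌈Real.sqrt (2 * L * N)⌉₊ : ℤ) ^ 2 := by
    intro n hn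
    have h := (hvals n hn).trans ((Real.sq_sqrt hx0).symm.le.trans
      (pow_le_pow_left₀ (Real.sqrt_nonneg _) (Nat.le_ceil (Real.sqrt (2 * L * N))) 2))
    exact_mod_cast h
  have hMc : (⌈Real.sqrt (2 * L * N)⌉₊ : ℝ) + 1 ≤ c * (N : ℝ) ^ ((1 : ℝ) / 2) := by
    have h1 : (⌈Real.sqrt (2 * L * N)⌉₊ : ℝ) < Real.sqrt (2 * L * N) + 1 :=
      Nat.ceil_lt_add_one (Real.sqrt_nonneg _)
    rw [hc]
    linarith [hsx, hw2]
  -- (1) the crude Mertens bound for `V(N^{1/8})`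
  have hVle : ∏ q ∈ Nat.primesBelow ⌈(N : ℝ) ^ ((1 : ℝ) / 8)⌉₊, (1 - sectionDensity Ψ i q) ≤
      8 * |C3| * Real.log (Real.log N) / Real.log N := by
    have hlz0 : 0 < Real.log ((N : ℝ) ^ ((1 : ℝ) / 8)) := by rw [hlogz]; positivity
    calc _ ≤ C3 * Real.log (Real.log N) / Real.log ((N : ℝ) ^ ((1 : ℝ) / 8)) :=
          (h3 N hN3 Ψ hΨ hΨL i hlt1 hS).2 _ hz2 hzN
      _ ≤ |C3| * Real.log (Real.log N) / Real.log ((N : ℝ) ^ ((1 : ℝ) / 8)) :=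
          div_le_div_of_nonneg_right (mul_le_mul_of_nonneg_right (le_abs_self C3) hm0.le) hlz0.le
      _ = 8 * |C3| * Real.log (Real.log N) / Real.log N := by rw [hlogz]; field_simp
  -- (2) the fibre mass through the rough tuples of the frozen sub-system
  have hB₁ : (sectionMass Ψ K N 2 i j' 1 : ℝ) ≤
      |CR| * Real.log (Real.log N) ^ t * N / Real.log N ^ t := by
    have h2u : (2 : ℝ) ≤ (N : ℝ) ^ ((1 : ℝ) / (2 : ℕ)) := by rw [Nat.cast_ofNat]; exact hw2
    have h2 := hR N hNR (Fin.removeNth i Ψ) (SingularRatio.isNondegenerateSystem_removeNth hΨ i)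
      ((affLinSize_removeNth_le Ψ i N).trans hΨL)
    refine ((Nat.cast_le (α := ℝ)).mpr (hPrep.2.2.1 t Ψ K N 2 i j' h2u).2).trans (h2.trans ?_)
    apply div_le_div_of_nonneg_right _ (by positivity)
    exact mul_le_mul_of_nonneg_right
      (mul_le_mul_of_nonneg_right (le_abs_self CR) (by positivity)) (Nat.cast_nonneg N)
  -- (3) sieve, with the window bound (4) and the re-indexed remainders (5) still to be supplied
  refine (cell_two_le hSF Ψ K N i j' hCI hF2 hG0.le hdim hx0 hvals hvalsM hz2 hzy hs hy1 hzhalf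
    (a := KW / Real.log N) (r := N / Real.log N ^ (t + 3)) ?_ hB₁ hVle ?_).trans ?_
  · -- (4) the window bound
    refine (window_sum_le hdim hw2 hc1 hMc _ fun p hp => ?_).trans_eq ?_
    · have h1 := Finset.mem_filter.mp hp
      have hpM : (p : ℝ) ≤ ⌈Real.sqrt (2 * L * N)⌉₊ := by exact_mod_cast (Finset.mem_Icc.mp h1.1).2
      exact ⟨h1.2.1, h1.2.2.le, by linarith⟩
    · rw [hlogw, hKW]; field_simp
  · -- (5) the remainders, re-indexed into the atom's squarefree moduli, then the atom
    exact le_trans (hPrep.2.2.2.2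
      (fun m => |(sectionMass Ψ K N 2 i j' m : ℝ) -
        sectionDensity Ψ i m * (sectionMass Ψ K N 2 i j' 1 : ℝ)|) _ ((N : ℝ) ^ ((1 : ℝ) / 8)) _
      ⌊(N : ℝ) ^ (1 - 1 / Real.log (Real.log N) ^ 1)⌋₊ (fun m => abs_nonneg _)
      (fun p hp => ⟨(Finset.mem_filter.mp hp).2.1, hzhalf.trans (Finset.mem_filter.mp hp).2.2.le⟩)
      (fun p hp d hd => mul_le_level hN1 hcN hMc hm8 (Finset.mem_Icc.mp (Finset.mem_filter.mp hp).1).2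
        (Finset.mem_range.mp (Finset.mem_filter.mp hd).1)))
      (hAt N hNA Ψ hΨ hΨL K hK hKN i j' hj')
  · -- (6) the budget: `KM (log log N)^{t+1} N / log^{t+2} N + N / log^{t+3} N ≤ E/2 + E/2`
    calc _ = KM * Real.log (Real.log N) ^ (t + 1) * N / Real.log N ^ (t + 2) +
          N / Real.log N ^ (t + 3) := by
          rw [hKM, hKW]
          field_simp
          ring
      _ ≤ (N : ℝ) / (Real.log N ^ (t + 1) * Real.log (Real.log N) ^ B) / 2 +
          (N : ℝ) / (Real.log N ^ (t + 1) * Real.log (Real.log N) ^ B) / 2 :=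
          add_le_add (main_le_half hℓ0 hm0 hN0.le hKMℓ) (rem_le_half (by linarith) hm0 hN0.le h2ℓ)
      _ = (N : ℝ) / (Real.log N ^ (t + 1) * Real.log (Real.log N) ^ B) := add_halves _

end Summit.Parity.GeneralizedHardyLittlewood.Cruxes.CellParityLaw.SectionAnnihilator

end
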